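import Summits.KontsevichZagierPeriods.KontsevichZagierPeriods.Theorems.SymplecticScissorsRealOnePeriodRelationsStubTransferTorsA
import Mathlib.Tactic.Module

/-!
# Crux `RealOnePeriodRelations` (stmt-KontsevichZagierPeriods-10042), line `nash-retraction-thin-strip`, reshape 10:
# transfer of symbols on `C_T` — the THIRD-KIND piece `ξ_t` (towards the lead's stub `stub_transferTors`)

Uniform transfer lemmas `transfer_*`: each standard piece `π` of a form on `C_T` comes with a finitely supported
`V : PeriodSymbol →₀ ℂ` with algebraic coefficients, supported on symbols on `E_L`, `𝔾ₘ = {xy = 1}` and `𝔸¹`, such that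
`(C_T, π, γ) − V` lies in the `ℚ̄`-span of the elementary relations:

* `transfer_Theta0`, `transfer_Theta1`, `transfer_dlogV`, `transfer_exact`, `transfer_vanish` (from `…StubTransferTorsA`);
* `transfer_Xi` — the third-kind form `ξ_t = dx/((x − t) y)` at a torsion abscissa `t = ℘(v)`:
  - if `2v ∈ Λ` (`f(t) = 0`): `ξ_t` is of the second kind (`vanishesOn_xi_twoTorsion`), a combination of `θ₀, θ₁` on `E_L` and `𝟙`;
  - if `2v ∉ Λ`: with the torsion units `G_±` of `stub_torsUnit` and the unit maps
    `Φ_± = (G_±, c⁻¹ G_∓ (x − t)^{−N}) : C_T → 𝔾ₘ`, the identity `dlog G₊ − dlog G₋ = (N ℘′(v)/2) ξ_t − λ θ₀` on `C_T`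
    (`vanishesOn_xi_unit`) makes `(C_T, ξ_t, γ)` a combination of the logarithm symbols `(𝔾ₘ, y dx, Φ_± ∘ γ)` and
    `(E_L, θ₀, ι ∘ γ)` — the torsion trick for periods of the third kind.

[cite: HuberWustholz2022, §13.1 (B), §13.2, §18.1] [cite: SilvermanAEC2009, III.3.5]
-/

noncomputable section

open scoped BigOperators Topology PeriodPair
open Set Filter MvPolynomial Complex
open Literature.NumberTheory.Transcendental Literature.NumberTheory.Transcendental.CurvePeriods
open Literature.NumberTheory.Transcendental.CurvePeriods.Ell

namespace Summit.KontsevichZagierPeriods.SymplecticScissors.RealOnePeriodRelations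

namespace TorsionLayer

variable (L : PeriodPair)

/-! ### Uniform transfer of the first/second-kind pieces -/

/-- Values of `single x a` are algebraic when `a` is. [folklore] -/
theorem isAlgebraic_single_apply_of : ∀ (x t : PeriodSymbol) {a : ℂ}, IsAlgebraic ℚ a → IsAlgebraic ℚ ((Finsupp.single x a) t) := by
  intro x t a ha
  classical
  rw [Finsupp.single_apply]
  split_ifs
  · exact ha
  · exact isAlgebraic_zero

/-- **Transfer of `Θ₀`**: `V = (E_L, θ₀, ι∘γ)`. [cite: HuberWustholz2022, §13.1 (B)] -/
theorem transfer_Theta0 (h₂ : IsAlgebraic ℚ L.g₂) (h₃ : IsAlgebraic ℚ L.g₃) {T : Finset ℂ} (hT : ∀ a ∈ T, IsAlgebraic ℚ a)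
    (γ : CurvePath (curveP L T)) :
    ∃ V : PeriodSymbol →₀ ℂ, (∀ s, IsAlgebraic ℚ (V s)) ∧
      (∃ (k : ℕ) (ρ : Fin k → (PeriodSymbol →₀ ℂ)) (a : Fin k → ℂ),
      (∀ l, IsElementaryRelation (ρ l)) ∧ (∀ l, IsAlgebraic ℚ (a l)) ∧ (Finsupp.single (⟨curveP L T, smoothP L h₂ h₃ hT, Theta0 L, hasAlgCoeffs_Theta0 L h₂ h₃, γ⟩ : PeriodSymbol) (1 : ℂ) - V) = ∑ l, a l • ρ l) ∧
      ∀ s ∈ V.support, (s.Z = curve L ∨ s.Z = (⟨2, 1, ![X 0 * X 1 - 1]⟩ : CurveData) ∨ s.Z = CurveData.affineLine) := by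
  obtain ⟨δ, hδ⟩ := exists_iotaPath L T γ
  refine ⟨Finsupp.single (⟨curve L, smooth L h₂ h₃, theta0 L, hasAlgCoeffs_theta0 L h₂ h₃, δ⟩ : PeriodSymbol) 1,
    fun s => isAlgebraic_single_apply_of _ _ isAlgebraic_one, span_Theta0 L h₂ h₃ hT γ δ hδ, fun s hs => ?_⟩
  rw [Finsupp.support_single _ one_ne_zero, Finset.mem_singleton] at hs
  subst hs
  exact Or.inl rfl

/-- **Transfer of `Θ₁`**: `V = (E_L, θ₁, ι∘γ)`. [cite: HuberWustholz2022, §13.1 (B)] -/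
theorem transfer_Theta1 (h₂ : IsAlgebraic ℚ L.g₂) (h₃ : IsAlgebraic ℚ L.g₃) {T : Finset ℂ} (hT : ∀ a ∈ T, IsAlgebraic ℚ a)
    (γ : CurvePath (curveP L T)) :
    ∃ V : PeriodSymbol →₀ ℂ, (∀ s, IsAlgebraic ℚ (V s)) ∧
      (∃ (k : ℕ) (ρ : Fin k → (PeriodSymbol →₀ ℂ)) (a : Fin k → ℂ),
      (∀ l, IsElementaryRelation (ρ l)) ∧ (∀ l, IsAlgebraic ℚ (a l)) ∧ (Finsupp.single (⟨curveP L T, smoothP L h₂ h₃ hT, Theta1 L, hasAlgCoeffs_Theta1 L h₂ h₃, γ⟩ : PeriodSymbol) (1 : ℂ) - V) = ∑ l, a l • ρ l) ∧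
      ∀ s ∈ V.support, (s.Z = curve L ∨ s.Z = (⟨2, 1, ![X 0 * X 1 - 1]⟩ : CurveData) ∨ s.Z = CurveData.affineLine) := by
  obtain ⟨δ, hδ⟩ := exists_iotaPath L T γ
  refine ⟨Finsupp.single (⟨curve L, smooth L h₂ h₃, theta1 L, hasAlgCoeffs_theta1 L h₂ h₃, δ⟩ : PeriodSymbol) 1,
    fun s => isAlgebraic_single_apply_of _ _ isAlgebraic_one, span_Theta1 L h₂ h₃ hT γ δ hδ, fun s hs => ?_⟩
  rw [Finsupp.support_single _ one_ne_zero, Finset.mem_singleton] at hs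
  subst hs
  exact Or.inl rfl

/-- **Transfer of `dx/(x − t)`**: `V = (𝔾ₘ, y dx, (x − t, (x − t)⁻¹)∘γ)`. [cite: HuberWustholz2022, §13.1 (B)] -/
theorem transfer_dlogV (h₂ : IsAlgebraic ℚ L.g₂) (h₃ : IsAlgebraic ℚ L.g₃) {T : Finset ℂ} (hT : ∀ a ∈ T, IsAlgebraic ℚ a)
    {t : ℂ} (ht : t ∈ T) (γ : CurvePath (curveP L T)) :
    ∃ V : PeriodSymbol →₀ ℂ, (∀ s, IsAlgebraic ℚ (V s)) ∧
      (∃ (k : ℕ) (ρ : Fin k → (PeriodSymbol →₀ ℂ)) (a : Fin k → ℂ),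
      (∀ l, IsElementaryRelation (ρ l)) ∧ (∀ l, IsAlgebraic ℚ (a l)) ∧ (Finsupp.single (⟨curveP L T, smoothP L h₂ h₃ hT, dlogV T t, hasAlgCoeffs_dlogV hT t, γ⟩ : PeriodSymbol) (1 : ℂ) - V) = ∑ l, a l • ρ l) ∧
      ∀ s ∈ V.support, (s.Z = curve L ∨ s.Z = (⟨2, 1, ![X 0 * X 1 - 1]⟩ : CurveData) ∨ s.Z = CurveData.affineLine) := by
  obtain ⟨γ', -, hrel⟩ := span_dlogV L h₂ h₃ hT ht γ
  refine ⟨Finsupp.single (⟨⟨2, 1, ![X 0 * X 1 - 1]⟩, isSmoothAffineCurve_mulGroup, ![X 1, 0], hasAlgCoeffs_ydx, γ'⟩ :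
    PeriodSymbol) 1, fun s => isAlgebraic_single_apply_of _ _ isAlgebraic_one, hrel, fun s hs => ?_⟩
  rw [Finsupp.support_single _ one_ne_zero, Finset.mem_singleton] at hs
  subst hs
  exact Or.inr (Or.inl rfl)

/-- **Transfer of an exact form `dF`**: `V = (F(γ 1) − F(γ 0)) · 𝟙` ((R3)). [cite: HuberWustholz2022, §13.1 (A)] -/
theorem transfer_exact (h₂ : IsAlgebraic ℚ L.g₂) (h₃ : IsAlgebraic ℚ L.g₃) {T : Finset ℂ} (hT : ∀ a ∈ T, IsAlgebraic ℚ a)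
    {F : MvPolynomial (Fin 3) ℂ} (hF : HasAlgCoeffs F) (γ : CurvePath (curveP L T)) :
    ∃ V : PeriodSymbol →₀ ℂ, (∀ s, IsAlgebraic ℚ (V s)) ∧
      (∃ (k : ℕ) (ρ : Fin k → (PeriodSymbol →₀ ℂ)) (a : Fin k → ℂ),
      (∀ l, IsElementaryRelation (ρ l)) ∧ (∀ l, IsAlgebraic ℚ (a l)) ∧ (Finsupp.single (⟨curveP L T, smoothP L h₂ h₃ hT, formD F, hF.formD, γ⟩ : PeriodSymbol) (1 : ℂ) - V) = ∑ l, a l • ρ l) ∧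
      ∀ s ∈ V.support, (s.Z = curve L ∨ s.Z = (⟨2, 1, ![X 0 * X 1 - 1]⟩ : CurveData) ∨ s.Z = CurveData.affineLine) := by
  have he : IsAlgebraic ℚ (eval (γ.toFun 1) F - eval (γ.toFun 0) F) :=
    (hF.isAlgebraic_eval γ.algebraic_one).sub (hF.isAlgebraic_eval γ.algebraic_zero)
  refine ⟨(eval (γ.toFun 1) F - eval (γ.toFun 0) F) • Finsupp.single PeriodSymbol.unit (1 : ℂ),
    fun s => ?_, span_of_rel (IsElementaryRelation.exact _ (smoothP L h₂ h₃ hT) γ F hF _ hF.formD rfl), fun s hs => ?_⟩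
  · rw [Finsupp.smul_apply, smul_eq_mul]
    exact he.mul (isAlgebraic_single_apply_of _ _ isAlgebraic_one)
  · have h3 := (Finsupp.mem_support_single _ _ _).1 (Finsupp.support_smul hs)
    rw [h3.1]
    exact Or.inr (Or.inr rfl)

/-- **Transfer of a vanishing form**: `V = 0` ((R2)). [cite: HuberWustholz2022, §13.1 (A)] -/
theorem transfer_vanish (h₂ : IsAlgebraic ℚ L.g₂) (h₃ : IsAlgebraic ℚ L.g₃) {T : Finset ℂ} (hT : ∀ a ∈ T, IsAlgebraic ℚ a)
    {ν : Fin 3 → MvPolynomial (Fin 3) ℂ} (hν : ∀ i, HasAlgCoeffs (ν i)) (hv : VanishesOn (curveP L T) ν)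
    (γ : CurvePath (curveP L T)) :
    ∃ V : PeriodSymbol →₀ ℂ, (∀ s, IsAlgebraic ℚ (V s)) ∧
      (∃ (k : ℕ) (ρ : Fin k → (PeriodSymbol →₀ ℂ)) (a : Fin k → ℂ),
      (∀ l, IsElementaryRelation (ρ l)) ∧ (∀ l, IsAlgebraic ℚ (a l)) ∧ (Finsupp.single (⟨curveP L T, smoothP L h₂ h₃ hT, ν, hν, γ⟩ : PeriodSymbol) (1 : ℂ) - V) = ∑ l, a l • ρ l) ∧
      ∀ s ∈ V.support, (s.Z = curve L ∨ s.Z = (⟨2, 1, ![X 0 * X 1 - 1]⟩ : CurveData) ∨ s.Z = CurveData.affineLine) :=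
  ⟨0, fun _ => isAlgebraic_zero, by
    rw [sub_zero]; exact span_of_rel (IsElementaryRelation.vanish _ (smoothP L h₂ h₃ hT) γ ν hν hv),
    fun s hs => by simp at hs⟩


/-! ### A combinator: transferring a combination of transferred pieces -/

/-- **Transfer of a `ℚ̄`-combination of transferable pieces.** If `π = Σ_{i∈S} cᵢ • ωᵢ` with algebraic `cᵢ` and every
`(C_T, ωᵢ, γ)` transfers to `Vᵢ`, then `(C_T, π, γ)` transfers to `Σ cᵢ • Vᵢ` (iterated (R1)). [cite: HuberWustholz2022, §13.1 (A)] -/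
theorem transfer_combo (h₂ : IsAlgebraic ℚ L.g₂) (h₃ : IsAlgebraic ℚ L.g₃) {T : Finset ℂ} (hT : ∀ a ∈ T, IsAlgebraic ℚ a)
    (γ : CurvePath (curveP L T)) {ι' : Type*} (S : Finset ι') (ω : ι' → Fin 3 → MvPolynomial (Fin 3) ℂ)
    (hω : ∀ i k, HasAlgCoeffs (ω i k)) (c : ι' → ℂ) (hc : ∀ i, IsAlgebraic ℚ (c i))
    (hV : ∀ i ∈ S, ∃ V : PeriodSymbol →₀ ℂ, (∀ s, IsAlgebraic ℚ (V s)) ∧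
      (∃ (k : ℕ) (ρ : Fin k → (PeriodSymbol →₀ ℂ)) (a : Fin k → ℂ),
      (∀ l, IsElementaryRelation (ρ l)) ∧ (∀ l, IsAlgebraic ℚ (a l)) ∧ (Finsupp.single (⟨curveP L T, smoothP L h₂ h₃ hT, ω i, hω i, γ⟩ : PeriodSymbol) (1 : ℂ) - V) = ∑ l, a l • ρ l) ∧
      ∀ s ∈ V.support, (s.Z = curve L ∨ s.Z = (⟨2, 1, ![X 0 * X 1 - 1]⟩ : CurveData) ∨ s.Z = CurveData.affineLine))
    (π : Fin 3 → MvPolynomial (Fin 3) ℂ) (hπ : ∀ k, HasAlgCoeffs (π k)) (heq : π = ∑ i ∈ S, c i • ω i) :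
    ∃ V : PeriodSymbol →₀ ℂ, (∀ s, IsAlgebraic ℚ (V s)) ∧
      (∃ (k : ℕ) (ρ : Fin k → (PeriodSymbol →₀ ℂ)) (a : Fin k → ℂ),
      (∀ l, IsElementaryRelation (ρ l)) ∧ (∀ l, IsAlgebraic ℚ (a l)) ∧ (Finsupp.single (⟨curveP L T, smoothP L h₂ h₃ hT, π, hπ, γ⟩ : PeriodSymbol) (1 : ℂ) - V) = ∑ l, a l • ρ l) ∧
      ∀ s ∈ V.support, (s.Z = curve L ∨ s.Z = (⟨2, 1, ![X 0 * X 1 - 1]⟩ : CurveData) ∨ s.Z = CurveData.affineLine) := by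
  classical
  have hZ := smoothP L h₂ h₃ hT
  choose! V hValg hVrel hVsupp using hV
  have hS : ∀ k, HasAlgCoeffs ((∑ i ∈ S, c i • ω i) k) :=
    fun k => hasAlgCoeffs_sum_apply S _ (fun i k => (hω i k).smul (hc i)) k
  refine ⟨∑ i ∈ S, c i • V i, fun s => ?_, ?_, fun s hs => ?_⟩
  · rw [Finsupp.finsetSum_apply]
    refine isAlgebraic_finsetSum _ _ fun i hi => ?_
    rw [Finsupp.smul_apply, smul_eq_mul]
    exact (hc i).mul (hValg i hi s)
  · have r₁ := span_single_sum_smul (curveP L T) hZ γ S ω hω c hc hS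
    have r₂ : (∃ (k : ℕ) (ρ : Fin k → (PeriodSymbol →₀ ℂ)) (a : Fin k → ℂ),
      (∀ l, IsElementaryRelation (ρ l)) ∧ (∀ l, IsAlgebraic ℚ (a l)) ∧ (∑ i ∈ S, c i • (Finsupp.single (⟨curveP L T, hZ, ω i, hω i, γ⟩ : PeriodSymbol) (1 : ℂ) - V i)) = ∑ l, a l • ρ l) :=
      CurvePeriods.span_finsetSum S _ fun i hi => span_smul (hc i) (hVrel i hi)
    obtain ⟨k, ρ, cf, hρ, hcf, hsum⟩ := span_add r₁ r₂
    refine ⟨k, ρ, cf, hρ, hcf, ?_⟩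
    rw [PeriodSymbol.mk_eq_mk hZ hπ hS γ heq, ← hsum]
    simp only [smul_sub, Finset.sum_sub_distrib]
    abel
  · obtain ⟨i, hi, hmem⟩ := Finset.mem_biUnion.1 (Finsupp.support_finsetSum hs)
    exact hVsupp i hi s (Finsupp.support_smul hmem)

/-! ### The third-kind piece `ξ_t` at a `2`-torsion abscissa -/

/-- **Transfer of `ξ_t` at a `2`-torsion abscissa** (`f(t) = 0`): `ξ_t = (1/f′(t)) θ₁ − (t/f′(t)) θ₀ − (2/f′(t)) d(y/(x − t)) + ν`.
[cite: HuberWustholz2022, §13.2] -/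
theorem transfer_Xi_two (h₂ : IsAlgebraic ℚ L.g₂) (h₃ : IsAlgebraic ℚ L.g₃) {T : Finset ℂ} (hT : ∀ a ∈ T, IsAlgebraic ℚ a)
    {t : ℂ} (ht : t ∈ T) (hft : t ^ 3 + A L * t + B L = 0) (γ : CurvePath (curveP L T)) :
    ∃ V : PeriodSymbol →₀ ℂ, (∀ s, IsAlgebraic ℚ (V s)) ∧
      (∃ (k : ℕ) (ρ : Fin k → (PeriodSymbol →₀ ℂ)) (a : Fin k → ℂ),
      (∀ l, IsElementaryRelation (ρ l)) ∧ (∀ l, IsAlgebraic ℚ (a l)) ∧ (Finsupp.single (⟨curveP L T, smoothP L h₂ h₃ hT, Xi L T t, hasAlgCoeffs_Xi L h₂ h₃ hT t, γ⟩ : PeriodSymbol) (1 : ℂ) - V) = ∑ l, a l • ρ l) ∧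
      ∀ s ∈ V.support, (s.Z = curve L ∨ s.Z = (⟨2, 1, ![X 0 * X 1 - 1]⟩ : CurveData) ∨ s.Z = CurveData.affineLine) := by
  classical
  have hE := smoothP L h₂ h₃ hT
  have hta : IsAlgebraic ℚ t := hT t ht
  have hAa : IsAlgebraic ℚ (A L) := isAlgebraic_A L h₂
  -- `f′(t) ≠ 0`
  have hf' : 3 * t ^ 2 + A L ≠ 0 := by
    intro h0
    have hb := Weier.eval_bezout (A L) (B L) ![t, 0]
    rw [Weier.eval_pderiv_zero_fPoly, Weier.eval_fPoly] at hb
    simp only [Matrix.cons_val_zero] at hb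
    rw [h0, hft, mul_zero, mul_zero, sub_zero] at hb
    exact disc_ne_zero L hb.symm
  have hf'a : IsAlgebraic ℚ (3 * t ^ 2 + A L) := ((isAlgebraic_nat 3).mul (hta.pow 2)).add hAa
  -- the pieces
  set P₁ : MvPolynomial (Fin 3) ℂ := X 1 * invX T t with hP₁
  have hP₁a : HasAlgCoeffs P₁ := (hasAlgCoeffs_X 1).mul (hasAlgCoeffs_invX hT t)
  set VAN : Fin 3 → MvPolynomial (Fin 3) ℂ :=
    formD P₁ - (1 / 2 : ℂ) • Theta1 L + (t / 2) • Theta0 L + ((3 * t ^ 2 + A L) / 2) • Xi L T t with hVAN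
  have hVANv : VanishesOn (curveP L T) VAN := vanishesOn_xi_twoTorsion L hE ht hft
  have hΘ0 := hasAlgCoeffs_Theta0 L h₂ h₃
  have hΘ1 := hasAlgCoeffs_Theta1 L h₂ h₃
  have hXi := hasAlgCoeffs_Xi L h₂ h₃ hT t
  have hhalf : IsAlgebraic ℚ ((1 : ℂ) / 2) := by rw [one_div]; exact (isAlgebraic_nat 2).inv
  have ht2 : IsAlgebraic ℚ (t / 2) := by rw [div_eq_mul_inv]; exact hta.mul (isAlgebraic_nat 2).inv
  have hf2 : IsAlgebraic ℚ ((3 * t ^ 2 + A L) / 2) := by rw [div_eq_mul_inv]; exact hf'a.mul (isAlgebraic_nat 2).inv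
  have hVANa : ∀ k, HasAlgCoeffs (VAN k) := by
    intro k
    simp only [hVAN, Pi.add_apply, Pi.sub_apply, Pi.smul_apply]
    exact ((((hP₁a.formD k).sub ((hΘ1 k).smul hhalf)).add ((hΘ0 k).smul ht2)).add ((hXi k).smul hf2))
  let ω : Fin 4 → Fin 3 → MvPolynomial (Fin 3) ℂ := ![Theta1 L, Theta0 L, formD P₁, VAN]
  set sc : ℂ := (3 * t ^ 2 + A L) / 2 with hsc
  have hsc0 : sc ≠ 0 := div_ne_zero hf' two_ne_zero
  set κ : ℂ := sc⁻¹ with hκ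
  have hκa : IsAlgebraic ℚ κ := by rw [hκ, hsc, div_eq_mul_inv]; exact (hf'a.mul (isAlgebraic_nat 2).inv).inv
  let c : Fin 4 → ℂ := ![κ / 2, -(κ * t / 2), -κ, κ]
  have hω : ∀ i k, HasAlgCoeffs (ω i k) := by
    intro i k
    fin_cases i
    · exact hΘ1 k
    · exact hΘ0 k
    · exact hP₁a.formD k
    · exact hVANa k
  have h2inv : IsAlgebraic ℚ ((2 : ℂ)⁻¹) := (isAlgebraic_nat 2).inv
  have hc : ∀ i, IsAlgebraic ℚ (c i) := by
    intro i
    fin_cases i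
    · show IsAlgebraic ℚ (κ / 2)
      rw [div_eq_mul_inv]; exact hκa.mul h2inv
    · show IsAlgebraic ℚ (-(κ * t / 2))
      rw [div_eq_mul_inv]; exact ((hκa.mul hta).mul h2inv).neg
    · show IsAlgebraic ℚ (-κ)
      exact hκa.neg
    · show IsAlgebraic ℚ κ
      exact hκa
  have heq : Xi L T t = ∑ i ∈ Finset.univ, c i • ω i := by
    symm
    calc ∑ i ∈ Finset.univ, c i • ω i
        = (κ / 2) • Theta1 L + (-(κ * t / 2)) • Theta0 L + (-κ) • formD P₁ + κ • VAN := by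
          simp only [Fin.sum_univ_four, ω, c, Matrix.cons_val_zero, Matrix.cons_val_one, Matrix.cons_val_two]
          abel
      _ = (κ * sc) • Xi L T t := by rw [hVAN, hsc]; module
      _ = Xi L T t := by rw [hκ, inv_mul_cancel₀ hsc0, one_smul]
  refine transfer_combo L h₂ h₃ hT γ Finset.univ ω hω c hc (fun i _ => ?_) (Xi L T t) hXi heq
  fin_cases i
  · exact transfer_Theta1 L h₂ h₃ hT γ
  · exact transfer_Theta0 L h₂ h₃ hT γ
  · exact transfer_exact L h₂ h₃ hT hP₁a γ
  · exact transfer_vanish L h₂ h₃ hT hVANa hVANv γ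

end TorsionLayer

end Summit.KontsevichZagierPeriods.SymplecticScissors.RealOnePeriodRelations

end
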